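/-
Copyright (c) 2026. All rights reserved.
Released under Apache 2.0 license as described in the file LICENSE.
Authors: abc-iut cell — seat abc-iut-w5-d226 (wave 5).
-/
import Literature.AnabelianGeometry.AbsoluteAnabelian.ArchimedeanLogFrobeniusProp42Sub
import HarnessLib

/-!
# [AbsTopIII] Prop 4.2 (i), the clause `𝒞^hol_T = 𝒞̲^hol_T` in the tree's sense `AutHolPair.Hom.IsTIso` — PROOF

Sub-DAG `plan/L4/SUBDAG-AbsTopIII-Prop42.md`, row P42.i/L07.  In `ArchimedeanLogFrobeniusProp42Sub.lean`
(`ModelAutHolPair.homM_bijective_of_fieldIso`) the arithmetic part `φ_M` of a morphism of model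
Aut-holomorphic `T`-pairs whose `𝒜`-part is an induced isomorphism of topological fields (junction
P42.J27, a binder) was shown BIJECTIVE; the tree's notion of `T`-isomorphism
(`AutHolPair.Hom.IsTIso`, Def 4.1 (ii): "if `φ_M` is an isomorphism") also asks `φ_M` to be an OPEN map.
Here: `φ_M` IS the restriction `κ_{k*}⁻¹ ∘ ψA ∘ κ_k ∣ M_k → M_{k*}` of a homeomorphism of the fields
(`ModelAutHolPair.homM_eq_arithIso`), hence open, hence `φ.IsTIso` (`ModelAutHolPair.isTIso_of_fieldIso`).
Proof-only (kind=proof); bib key `MochizukiAbsTopIII2015`.  Refereed pre-IUT material; nothing here bears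
on the disputed [IUTchIII] Cor. 3.12.
-/

namespace Literature.AnabelianGeometry.AbsoluteAnabelian

open _root_.TopologicalSpace _root_.Topology

universe u

noncomputable section

namespace ModelAutHolPair

variable {T : ArchPairType} (P Q : ModelAutHolPair.{u} T)
  (hP₁ : ∀ x y : P.k, x ∈ P.arithData → y ∈ P.arithData → x * y ∈ P.arithData)
  (hP₂ : (1 : P.k) ∈ P.arithData)
  (hQ₁ : ∀ x y : Q.k, x ∈ Q.arithData → y ∈ Q.arithData → x * y ∈ Q.arithData)
  (hQ₂ : (1 : Q.k) ∈ Q.arithData)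

/-- The arithmetic part of a morphism of model pairs with induced field isomorphism `ψA` IS the
restriction of `σ = κ_{k*}⁻¹ ∘ ψA ∘ κ_k` to the arithmetic data (Kummer compatibility + injectivity of
`κ_{k*}`). [cite: MochizukiAbsTopIII2015, Proposition 4.2 (i) p.105] -/
theorem homM_eq_arithIso (φ : (P.toPair hP₁ hP₂).Hom (Q.toPair hQ₁ hQ₂)) (ψA : P.A.F ≃+* Q.A.F)
    (hφ : ∀ a, φ.homA a = ψA a) (hψ : Continuous ψA) (hψ' : Continuous ψA.symm)
    (m : (P.toPair hP₁ hP₂).M) :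
    φ.homM m = arithIso P Q hP₁ hP₂ hQ₁ hQ₂ (fieldIsoOfA P Q ψA)
      (image_arithData_eq P Q _ (continuous_fieldIsoOfA P Q ψA hψ)
        (continuous_fieldIsoOfA_symm P Q ψA hψ')) m := by
  apply Q.toPair_κM_injective hQ₁ hQ₂
  rw [φ.kummer_compat, hφ]
  change ψA (P.κ.κ m.1) = Q.κ.κ (fieldIsoOfA P Q ψA m.1)
  rw [fieldIsoOfA_apply, RingEquiv.apply_symm_apply]

/-- **P42.i/L07 in the tree's sense**: such a morphism is a `T`-isomorphism — `φ_M` is bijective AND open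
(it is the restriction of a homeomorphism of the fields). [cite: MochizukiAbsTopIII2015, Proposition 4.2 (i) p.105] -/
theorem isTIso_of_fieldIso (φ : (P.toPair hP₁ hP₂).Hom (Q.toPair hQ₁ hQ₂)) (ψA : P.A.F ≃+* Q.A.F)
    (hφ : ∀ a, φ.homA a = ψA a) (hψ : Continuous ψA) (hψ' : Continuous ψA.symm) : φ.IsTIso := by
  have hσ := continuous_fieldIsoOfA P Q ψA hψ
  have hσ' := continuous_fieldIsoOfA_symm P Q ψA hψ'
  let e := arithIso P Q hP₁ hP₂ hQ₁ hQ₂ (fieldIsoOfA P Q ψA) (image_arithData_eq P Q _ hσ hσ')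
  have heq : ⇑φ.homM = ⇑e := funext (homM_eq_arithIso P Q hP₁ hP₂ hQ₁ hQ₂ φ ψA hφ hψ hψ')
  -- `e` with its continuity in both directions is a homeomorphism of the arithmetic data
  let eₜ : (P.toPair hP₁ hP₂).M ≃ₜ (Q.toPair hQ₁ hQ₂).M :=
    { e.toEquiv with
      continuous_toFun := (hσ.comp continuous_subtype_val).subtype_mk _
      continuous_invFun := (hσ'.comp continuous_subtype_val).subtype_mk _ }
  have heqₜ : ⇑φ.homM = ⇑eₜ := heq
  refine ⟨?_, ?_⟩
  · rw [heq]; exact e.bijective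
  · rw [heqₜ]; exact eₜ.isOpenMap

end ModelAutHolPair

end

end Literature.AnabelianGeometry.AbsoluteAnabelian
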